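import Mathlib
import HarnessLib

/-!
# Crux `EulerZoomLiouville.PowerGaugeEulerLiouville` (stmt-NavierStokesRegularity-19832), line `recurrent-past`, stub R1:
# A SET OF NON-ZERO WINDOW DENSITY MEETS THE COMPLEMENT OF A SET OF ZERO WINDOW DENSITY (`stub_densityMeet`, signature unfolded)

Route №10 `EulerZoomLiouville` (NavierStokesRegularity), crux E.  Line `recurrent-past` (ideator ns-idea-11 g3;
`Cruxes/PowerGaugeEulerLiouville/Lines/recurrent_past.lean`), registered stub `stub_densityMeet` (R1, «S»), proved here with the line's
`WindowDensityZero S := Tendsto (fun a => volume (S ∩ Ioo (−a²) 0) / ofReal (a²)) atTop (𝓝 0)` δ-UNFOLDED (so the skeleton fills the stub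
by `exact`).  Seat ns-ezl-w3 (default pick after A2 / D2′).

THE STATEMENT AND PROOF.  If `Bad` has window density zero and `Ret` does not, then some `σ ∈ Ret` lies outside `Bad`: otherwise `Ret ⊆ Bad`,
`volume (Ret ∩ I_a) ≤ volume (Bad ∩ I_a)` for every window `I_a = (−a², 0)`, and the density quotient of `Ret` is squeezed to `0` between `0`
and that of `Bad`.

WHAT THIS IS NOT: not NS, not the crux — a helper `--supports` stmt-19832 (elementary measure theory; R2 `stub_recurrentSlicesZero` is the
line's M-sized step, R3 its open residue); 19832 is a crux CLASS of Euler/NS strata and stays OPEN; nothing here bears on NS regularity.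
[folklore]
-/

noncomputable section

-- flat `Theorems/<Route><Decl>…` files of one crux share the namespace of the crux (tree convention)
set_option linter.dupNamespace false

open MeasureTheory Set Filter Topology
open scoped ENNReal Topology

namespace Summit.NavierStokesRegularity.NavierStokesRegularity.Theorems.PowerGaugeEulerLiouville.RecurrentPast

/-- **R1 `stub_densityMeet` of the line `recurrent-past`, signature unfolded** (`WindowDensityZero` written out): a set of past times whose
window density `volume (· ∩ (−a², 0)) / a²` does NOT tend to `0` is not contained in one whose window density tends to `0` (squeeze).
[folklore] -/
theorem densityMeet :
    ∀ Bad Ret : Set ℝ,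
      Tendsto (fun a : ℝ => volume (Bad ∩ Set.Ioo (-(a ^ 2)) 0) / ENNReal.ofReal (a ^ 2)) atTop (𝓝 0) →
      ¬ Tendsto (fun a : ℝ => volume (Ret ∩ Set.Ioo (-(a ^ 2)) 0) / ENNReal.ofReal (a ^ 2)) atTop (𝓝 0) →
        ∃ σ ∈ Ret, σ ∉ Bad := by
  intro Bad Ret hBad hRet
  by_contra hcon
  simp only [not_exists, not_and, not_not] at hcon
  have hsub : Ret ⊆ Bad := fun σ hσ => hcon σ hσ
  exact hRet (tendsto_of_tendsto_of_tendsto_of_le_of_le tendsto_const_nhds hBad (fun a => bot_le)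
    fun a => ENNReal.div_le_div_right (measure_mono (inter_subset_inter_left _ hsub)) _)

end Summit.NavierStokesRegularity.NavierStokesRegularity.Theorems.PowerGaugeEulerLiouville.RecurrentPast

end
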